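import Mathlib

/-!
# Route BarrierLever — item 20172 (CPM), benchmark row 14: a LINEAR-INDEPENDENCE TOOLKIT for the
# hierarchical Moore peel (leading coefficients over `B[X]`, row operations, scalar transfer)

Helper file (`--supports stmt-ValiantsHypothesis-20172`; cell valiant-natproofs, rung V4, 𝒟-side of
door (c), benchmark «row 14»; seat valiant-natproofs-prover gen 14).  Closes NO item; definition-free;
pure linear algebra, no reference to Chow forms.

The peel of planner p1 g18's memo (`HOME/p1/g18/MEMO-g18.md` §2.2, the «valuation lemma») is run on
LINEAR INDEPENDENCE of row families instead of determinants.  The tools: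

* `linearIndependent_of_coeff` — **leading-coefficient criterion**: a finite family of vectors
  `u k : col → B[X]` such that every entry of `u k` vanishes below degree `w k`, and whose
  degree-`w k` coefficient vectors are linearly independent over `B`, is linearly independent over
  `B[X]` (divide by the largest common power of `X`, read off the constant terms).
* `linearIndependent_of_sub_fixed` — subtracting, from the rows outside a set `F`, any combination
  of the rows inside `F` does not affect linear independence.
* `linearIndependent_of_block` — recombining the rows of a block `ι : Fin k ↪ K` by a matrix `N`
  that is cancellable (`N' * N = D • 1`, `D` a non-zero-divisor) does not create independence:
  if the recombined family is independent, so was the original.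
* `linearIndependent_smul_of_regular` — scaling rows by non-zero-divisors keeps independence;
  `linearIndependent_of_map_ringHom` — independence after an injective ring map implies
  independence before; `linearIndependent_unitVec` — distinct unit vectors are independent;
  `det_ne_zero_of_linearIndependent_rows'` — over a domain, independent rows give `det ≠ 0`.

WHAT THIS IS NOT: bookkeeping; nothing here mentions items 20172 / 20195 / 19717, crux
stmt-ValiantsHypothesis-14610, or `VP` versus `VNP`.
-/

set_option linter.dupNamespace false

namespace Summit.ValiantsHypothesis.ValiantsHypothesis.Theorems.BarrierLever.MoorePeel

open Polynomial

section Scalars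

variable {S : Type*} [CommRing S] {M : Type*} [AddCommGroup M] [Module S M] {K : Type*} [Fintype K]

/-- Scaling the members of an independent family by non-zero-divisors keeps it independent. -/
theorem linearIndependent_smul_of_regular (v : K → M) (s : K → S)
    (hs : ∀ k x, s k * x = 0 → x = 0) (hv : LinearIndependent S v) :
    LinearIndependent S (fun k => s k • v k) := by
  rw [Fintype.linearIndependent_iff] at hv ⊢
  intro g hg k
  have h1 : ∑ k, (g k * s k) • v k = 0 := by
    simpa only [mul_smul] using hg
  have := hv (fun k => g k * s k) h1 k
  exact hs k (g k) (by rwa [mul_comm] at this)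

/-- **Row reduction against fixed rows.**  If the family obtained from `v` by subtracting from every
row outside `F` a combination `Σ_{l ∈ F} π k l • v l` of rows inside `F` is linearly independent,
then `v` is linearly independent. -/
theorem linearIndependent_of_sub_fixed [DecidableEq K] (v : K → M) (F : Finset K) (π : K → K → S)
    (h : LinearIndependent S (fun k => if k ∈ F then v k else v k - ∑ l ∈ F, π k l • v l)) :
    LinearIndependent S v := by
  rw [Fintype.linearIndependent_iff] at h ⊢
  intro g hg
  set g' : K → S := fun k =>
    if k ∈ F then g k + ∑ x ∈ Finset.univ.filter (fun x => x ∉ F), g x * π x k else g k with hg'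
  have hsplit : ∀ f : K → M, ∑ k, f k =
      ∑ k ∈ F, f k + ∑ k ∈ Finset.univ.filter (fun x => x ∉ F), f k := by
    intro f
    rw [← Finset.sum_filter_add_sum_filter_not Finset.univ (fun k => k ∈ F)]
    congr 1
    exact Finset.sum_congr (by ext k; simp) fun _ _ => rfl
  have key : ∑ k, g' k • (if k ∈ F then v k else v k - ∑ l ∈ F, π k l • v l) = 0 := by
    rw [hsplit]
    have hF : ∑ k ∈ F, g' k • (if k ∈ F then v k else v k - ∑ l ∈ F, π k l • v l) =
        ∑ k ∈ F, g k • v k +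
          ∑ k ∈ F, (∑ x ∈ Finset.univ.filter (fun x => x ∉ F), g x * π x k) • v k := by
      rw [← Finset.sum_add_distrib]
      refine Finset.sum_congr rfl fun k hk => ?_
      rw [hg']
      simp only [hk, if_true, add_smul]
    have hC : ∑ k ∈ Finset.univ.filter (fun x => x ∉ F),
        g' k • (if k ∈ F then v k else v k - ∑ l ∈ F, π k l • v l) =
        ∑ k ∈ Finset.univ.filter (fun x => x ∉ F), g k • v k -
          ∑ k ∈ Finset.univ.filter (fun x => x ∉ F), g k • ∑ l ∈ F, π k l • v l := by
      rw [← Finset.sum_sub_distrib]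
      refine Finset.sum_congr rfl fun k hk => ?_
      have hk' : k ∉ F := (Finset.mem_filter.mp hk).2
      rw [hg']
      simp only [hk', if_false, smul_sub]
    rw [hF, hC]
    have hswap : ∑ k ∈ F, (∑ x ∈ Finset.univ.filter (fun x => x ∉ F), g x * π x k) • v k =
        ∑ k ∈ Finset.univ.filter (fun x => x ∉ F), g k • ∑ l ∈ F, π k l • v l := by
      simp_rw [Finset.sum_smul, Finset.smul_sum, mul_smul]
      rw [Finset.sum_comm]
    rw [hswap]
    have hg0 : ∑ k ∈ F, g k • v k + ∑ k ∈ Finset.univ.filter (fun x => x ∉ F), g k • v k = 0 := by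
      rw [← hsplit]
      exact hg
    rw [add_add_sub_cancel, hg0]
  have hz := h g' key
  have hoff : ∀ k, k ∉ F → g k = 0 := fun k hk => by
    have := hz k
    rw [hg'] at this
    simpa only [hk, if_false] using this
  intro k
  by_cases hk : k ∈ F
  · have := hz k
    rw [hg'] at this
    simp only [hk, if_true] at this
    rw [Finset.sum_eq_zero (fun x hx => by rw [hoff x (Finset.mem_filter.mp hx).2, zero_mul]),
      add_zero] at this
    exact this
  · exact hoff k hk

/-- **Cancellable recombination of a block of rows.**  Let `ι : Fin k → K` be injective and let `u`
agree with `v` off the image of `ι`, while on the image `u (ι j') = Σ_j N j' j • v (ι j)` for a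
matrix `N` admitting `N'` with `N' * N = D • 1`, `D` a non-zero-divisor.  If `u` is linearly
independent then so is `v`. -/
theorem linearIndependent_of_block [DecidableEq K] {k : ℕ} (v u : K → M) (ι : Fin k → K)
    (hι : Function.Injective ι) (N N' : Matrix (Fin k) (Fin k) S) (D : S)
    (hD : ∀ x : S, D * x = 0 → x = 0) (hNN : N' * N = D • (1 : Matrix (Fin k) (Fin k) S))
    (hon : ∀ j', u (ι j') = ∑ j, N j' j • v (ι j)) (hoff : ∀ x, x ∉ Set.range ι → u x = v x)
    (hu : LinearIndependent S u) : LinearIndependent S v := by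
  rw [Fintype.linearIndependent_iff] at hu ⊢
  intro g hg
  -- the block coefficients after recombination
  set c : Fin k → S := fun j' => ∑ l, g (ι l) * N' l j' with hc
  set g'' : K → S := fun x =>
    (if x ∈ Set.range ι then 0 else D * g x) + ∑ j', if ι j' = x then c j' else 0 with hg''
  -- splitting a sum over `K` into the block and its complement
  have hsplit : ∀ f : K → M, ∑ x, f x =
      ∑ j, f (ι j) + ∑ x ∈ Finset.univ.filter (fun x => x ∉ Set.range ι), f x := by
    intro f
    rw [← Finset.sum_filter_add_sum_filter_not Finset.univ (fun x => x ∈ Set.range ι)]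
    congr 1
    have himage : Finset.univ.filter (fun x => x ∈ Set.range ι) = Finset.univ.image ι := by
      ext x
      simp [Set.mem_range, eq_comm]
    rw [himage, Finset.sum_image fun a _ b _ e => hι e]
  have hcN : ∀ j, ∑ j', c j' * N j' j = D * g (ι j) := by
    intro j
    have e : ∀ j', c j' * N j' j = ∑ l, g (ι l) * (N' l j' * N j' j) := fun j' => by
      rw [hc, Finset.sum_mul]
      exact Finset.sum_congr rfl fun l _ => by ring
    rw [Finset.sum_congr rfl fun j' _ => e j', Finset.sum_comm]
    have e2 : ∀ l, ∑ j', g (ι l) * (N' l j' * N j' j) = g (ι l) * (N' * N) l j := fun l => by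
      rw [Matrix.mul_apply, Finset.mul_sum]
    rw [Finset.sum_congr rfl fun l _ => e2 l, hNN]
    simp only [Matrix.smul_apply, Matrix.one_apply, smul_eq_mul, mul_ite, mul_one, mul_zero]
    rw [Finset.sum_ite_eq' Finset.univ j]
    simp [mul_comm]
  have hblock_val : ∀ j₀, g'' (ι j₀) = c j₀ := by
    intro j₀
    rw [hg'']
    simp only [Set.mem_range_self, if_true, zero_add, hι.eq_iff]
    rw [Finset.sum_ite_eq' Finset.univ j₀]
    simp
  have hoff_val : ∀ x, x ∉ Set.range ι → g'' x = D * g x := by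
    intro x hx
    rw [hg'']
    simp only [hx, if_false]
    rw [Finset.sum_eq_zero (fun j' _ => if_neg (fun e => hx ⟨j', e⟩)), add_zero]
  -- main identity: `Σ_x g'' x • u x = D • Σ_x g x • v x = 0`
  have key : ∑ x, g'' x • u x = 0 := by
    rw [hsplit (fun x => g'' x • u x)]
    have h1 : ∑ j, g'' (ι j) • u (ι j) = ∑ j, (D * g (ι j)) • v (ι j) := by
      simp_rw [hblock_val, hon, Finset.smul_sum, smul_smul]
      rw [Finset.sum_comm]
      refine Finset.sum_congr rfl fun j _ => ?_
      rw [← Finset.sum_smul, hcN]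
    have h2 : ∑ x ∈ Finset.univ.filter (fun x => x ∉ Set.range ι), g'' x • u x =
        ∑ x ∈ Finset.univ.filter (fun x => x ∉ Set.range ι), (D * g x) • v x := by
      refine Finset.sum_congr rfl fun x hx => ?_
      have hx' : x ∉ Set.range ι := (Finset.mem_filter.mp hx).2
      rw [hoff_val x hx', hoff x hx']
    rw [h1, h2]
    have h3 : ∑ x, (D * g x) • v x = D • ∑ x, g x • v x := by
      rw [Finset.smul_sum]
      exact Finset.sum_congr rfl fun x _ => by rw [mul_smul]
    rw [← hsplit (fun x => (D * g x) • v x), h3, hg, smul_zero]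
  have hz := hu g'' key
  have hc0 : ∀ j', c j' = 0 := fun j' => by rw [← hblock_val j']; exact hz (ι j')
  intro x
  by_cases hx : x ∈ Set.range ι
  · obtain ⟨j, rfl⟩ := hx
    apply hD
    rw [← hcN j]
    exact Finset.sum_eq_zero fun j' _ => by rw [hc0 j', zero_mul]
  · apply hD
    rw [← hoff_val x hx]
    exact hz x

end Scalars

section RingChange

/-- **Independence transfers back along an injective ring map** (applied entrywise to vectors). -/
theorem linearIndependent_of_map_ringHom {A A' : Type*} [CommRing A] [CommRing A']
    (φ : A →+* A') (hφ : Function.Injective φ) {K col : Type*} [Fintype K] (v : K → col → A)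
    (h : LinearIndependent A' (fun k c => φ (v k c))) : LinearIndependent A v := by
  rw [Fintype.linearIndependent_iff] at h ⊢
  intro g hg k
  apply hφ
  rw [map_zero]
  refine h (fun k => φ (g k)) ?_ k
  funext c
  have := congrArg (fun f : col → A => φ (f c)) hg
  simpa only [Finset.sum_apply, Pi.smul_apply, smul_eq_mul, map_sum, map_mul, Pi.zero_apply,
    map_zero] using this

/-- Distinct unit vectors are linearly independent: if `e : K → col` is injective then the family
`k ↦ [c = e k]` is independent. -/
theorem linearIndependent_unitVec {A : Type*} [CommRing A] {K col : Type*} [Fintype K]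
    [DecidableEq col] (e : K → col) (he : Function.Injective e) :
    LinearIndependent A (fun k (c : col) => if c = e k then (1 : A) else 0) := by
  classical
  rw [Fintype.linearIndependent_iff]
  intro g hg k
  have := congrArg (fun f : col → A => f (e k)) hg
  simp only [Finset.sum_apply, Pi.smul_apply, smul_eq_mul, mul_ite, mul_one, mul_zero,
    Pi.zero_apply, he.eq_iff] at this
  rwa [Finset.sum_ite_eq Finset.univ k, if_pos (Finset.mem_univ k)] at this

/-- Over a domain, a square matrix with linearly independent rows has nonzero determinant. -/
theorem det_ne_zero_of_linearIndependent_rows' {A : Type*} [CommRing A] [IsDomain A]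
    {n : Type*} [Fintype n] [DecidableEq n] (M : Matrix n n A)
    (h : LinearIndependent A (fun i => M i)) : M.det ≠ 0 := by
  intro hdet
  obtain ⟨v, hv, hvM⟩ := (Matrix.exists_vecMul_eq_zero_iff (M := M)).mpr hdet
  rw [Matrix.vecMul_eq_sum] at hvM
  rw [Fintype.linearIndependent_iff] at h
  exact hv (funext fun i => h v hvM i)

end RingChange

section Leading

variable {B : Type*} [CommRing B] {K col : Type*} [Fintype K]

/-- **Leading-coefficient criterion** (the «valuation lemma» of the memo, §2.2, in linear-independence
form).  Let `u k : col → B[X]` be finitely many polynomial vectors, each with all entries vanishing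
below degree `w k`.  If the vectors of degree-`w k` coefficients are linearly independent over `B`,
then the `u k` are linearly independent over `B[X]`. -/
theorem linearIndependent_of_coeff (u : K → col → B[X]) (w : K → ℕ)
    (hlow : ∀ k c d, d < w k → (u k c).coeff d = 0)
    (hli : LinearIndependent B (fun k c => (u k c).coeff (w k))) :
    LinearIndependent B[X] u := by
  classical
  rw [Fintype.linearIndependent_iff] at hli ⊢
  intro g hg
  -- `u k c = X^{w k} * v k c`, constant term of `v k c` = leading coefficient of `u k c`
  have hdvd : ∀ k c, X ^ w k ∣ u k c := fun k c => Polynomial.X_pow_dvd_iff.mpr (hlow k c)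
  choose v hv using hdvd
  have hv0 : ∀ k c, (v k c).coeff 0 = (u k c).coeff (w k) := by
    intro k c
    rw [hv k c, Polynomial.coeff_X_pow_mul', if_pos le_rfl, Nat.sub_self]
  by_contra hne
  obtain ⟨k₁, hk₁⟩ := not_forall.mp hne
  set G : K → B[X] := fun k => g k * X ^ w k with hG
  have hGk₁ : G k₁ ≠ 0 := fun h0 => hk₁ ((Polynomial.monic_X_pow (w k₁)).mul_left_eq_zero_iff.mp h0)
  -- the minimal trailing degree over the nonzero `G k`
  obtain ⟨k₀, hk₀mem, hmin⟩ := Finset.exists_min_image (Finset.univ.filter fun k => G k ≠ 0)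
    (fun k => (G k).natTrailingDegree) ⟨k₁, Finset.mem_filter.mpr ⟨Finset.mem_univ _, hGk₁⟩⟩
  have hk₀ : G k₀ ≠ 0 := (Finset.mem_filter.mp hk₀mem).2
  set N := (G k₀).natTrailingDegree with hN
  have hdvdN : ∀ k, X ^ N ∣ G k := by
    intro k
    by_cases hk : G k = 0
    · rw [hk]
      exact dvd_zero _
    · rw [Polynomial.X_pow_dvd_iff]
      intro d hd
      exact Polynomial.coeff_eq_zero_of_lt_natTrailingDegree
        (lt_of_lt_of_le hd (hmin k (Finset.mem_filter.mpr ⟨Finset.mem_univ _, hk⟩)))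
  choose H hH using hdvdN
  have hH0 : (H k₀).coeff 0 ≠ 0 := by
    have e : (G k₀).coeff N = (H k₀).coeff 0 := by
      rw [hH k₀, Polynomial.coeff_X_pow_mul', if_pos le_rfl, Nat.sub_self]
    rw [← e]
    exact mt Polynomial.trailingCoeff_eq_zero.mp hk₀
  -- the relation divided by `X^N`
  have hrel : ∀ c, ∑ k, H k * v k c = 0 := by
    intro c
    have h1 : (∑ k, g k • u k) c = 0 := by rw [hg]; rfl
    rw [Finset.sum_apply] at h1
    simp only [Pi.smul_apply, smul_eq_mul] at h1
    have h2 : ∑ k, g k * u k c = X ^ N * ∑ k, H k * v k c := by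
      rw [Finset.mul_sum]
      refine Finset.sum_congr rfl fun k _ => ?_
      rw [hv k c, ← mul_assoc, show g k * X ^ w k = G k from rfl, hH k, mul_assoc]
    rw [h2] at h1
    exact (Polynomial.monic_X_pow N).mul_right_eq_zero_iff.mp h1
  -- its constant term is a nontrivial `B`-relation among the leading coefficient vectors
  have hrel0 : ∑ k, (H k).coeff 0 • (fun c => (u k c).coeff (w k)) = 0 := by
    funext c
    rw [Finset.sum_apply]
    simp only [Pi.smul_apply, smul_eq_mul, Pi.zero_apply]
    have := congrArg (fun p : B[X] => p.coeff 0) (hrel c)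
    simp only [Polynomial.finsetSum_coeff, Polynomial.mul_coeff_zero, Polynomial.coeff_zero,
      hv0] at this
    exact this
  exact hH0 (hli _ hrel0 k₀)

end Leading

end Summit.ValiantsHypothesis.ValiantsHypothesis.Theorems.BarrierLever.MoorePeel
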